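import Summits.QuantumAdvantage.QuantumAdvantage.Theorems.GaussRankPolyImpliesPPoly.Negative.MajoranaAction
import Summits.QuantumAdvantage.QuantumAdvantage.Theorems.GaussRankPolyImpliesPPoly.Negative.MajoranaCAR

/-!
# Negative lemmas III-d: the corner lemma `‖G(·,0000)‖ + ‖G(·,1111)‖ ≤ ‖G‖` for vectors satisfying the quadratic relations

Disprover's support file for crux `SpinorFlattening.GaussRankPolyImpliesPPoly` (stmt-QuantumAdvantage-1247),
refuter-cdisprove-stmt-QuantumAdvantage-1247-g2-0 (gen 2, 2026-08-16); work file `Cruxes/GaussRankPolyImpliesPPoly/Disproof.lean`.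
Part of the in-tree proof of the Gaussian fidelity bound `F_𝒢(M^{⊗t}) ≤ 2^{-t}` (CudbyStrelchuk2023 Lemma 3)
from the annihilator definition `IsGaussian` (files MajoranaAction → MajoranaCAR → QuadraticRelations →
CornerLemma → GaussianFidelity). Sorry-free; nothing here asserts a Theses statement.

THIS FILE: the quadratic relation at the label pair `(w·1000, w'·0111)` (`corner_relation`), its pairing
with the sign-twisted corner conditionals (`corner_pairing`: `Σ_q ⟨ã, c_qφ⟩⟨b̃, c_qφ'⟩ + Σ_k θ_k ⟨a, G(·,fA k)⟩⟨bb, G(·,fB k)⟩ = 0`),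
and the CORNER LEMMA: for every `G` on `b + 4` wires satisfying the relations,
`√‖G(·,0000)‖² + √‖G(·,1111)‖² ≤ √‖G‖²` (bilinear Majorana bound on the odd-pair term, Cauchy–Schwarz on the
three even mid pairs, AM–GM; at `b = 0` this is Cudby–Strelchuk's `|g₀| + |g₁₅| ≤ ‖g‖`).
-/

set_option linter.dupNamespace false

noncomputable section

namespace Summit.QuantumAdvantage.QuantumAdvantage.Theorems.GaussRankPolyImpliesPPoly.Negative

open Literature.Computability.Cryptography Literature.Computability.QuantumComplexity
open Matrix

/-- **The quadratic relation at the corner pair** `(w·1000, w'·0111)`: left-half part plus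
`(-1)^{|w|+|w'|} Σ_k θ_k G(w, fA k) G(w', fB k)`. [folklore] -/
theorem corner_relation {b : ℕ} {G : QReg (b + 4) → ℂ}
    (hG : (∀ u v : QReg (b + 4), ∑ p : Fin (b + 4) × Bool, (majorana (b + 4) p.1 p.2 *ᵥ G) u * (majorana (b + 4) p.1 p.2 *ᵥ G) v = 0)) (w w' : QReg b) :
    (∑ q : Fin b × Bool, (majorana b q.1 q.2 *ᵥ cond4 G s1000) w * (majorana b q.1 q.2 *ᵥ cond4 G s0111) w') +
      bsign w * bsign w' * ∑ k : Fin 4, theta k * (cond4 G (fA k) w * cond4 G (fB k) w') = 0 := by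
  have h := hG (Fin.append w s1000) (Fin.append w' s0111)
  rw [sum_majorana_split] at h
  have hB : (∑ q : Fin b × Bool, (majorana (b + 4) (Fin.castAdd 4 q.1) q.2 *ᵥ G) (Fin.append w s1000) *
      (majorana (b + 4) (Fin.castAdd 4 q.1) q.2 *ᵥ G) (Fin.append w' s0111)) =
      ∑ q : Fin b × Bool, (majorana b q.1 q.2 *ᵥ cond4 G s1000) w * (majorana b q.1 q.2 *ᵥ cond4 G s0111) w' :=
    Finset.sum_congr rfl fun q _ => by rw [majorana_castAdd_mulVec_append, majorana_castAdd_mulVec_append]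
  have hA : (∑ r : Fin 4 × Bool, (majorana (b + 4) (Fin.natAdd b r.1) r.2 *ᵥ G) (Fin.append w s1000) *
      (majorana (b + 4) (Fin.natAdd b r.1) r.2 *ᵥ G) (Fin.append w' s0111)) =
      bsign w * bsign w' * ∑ k : Fin 4, theta k * (cond4 G (fA k) w * cond4 G (fB k) w') := by
    rw [Fintype.sum_prod_type, Finset.mul_sum]
    refine Finset.sum_congr rfl fun k _ => ?_
    rw [Fintype.sum_bool, majorana_natAdd_mulVec_append, majorana_natAdd_mulVec_append,
      majorana_natAdd_mulVec_append, majorana_natAdd_mulVec_append, majorana_mulVec_apply,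
      majorana_mulVec_apply, majorana_mulVec_apply, majorana_mulVec_apply, update_s1000, update_s0111]
    unfold theta cond4
    ring
  rw [hB, hA] at h
  exact h

/-- Triple-sum bookkeeping: `Σ_w Σ_w' α_w β_w' Σ_k c_k u_k(w) v_k(w') = Σ_k c_k (Σ_w α_w u_k w)(Σ_w' β_w' v_k w')`.
[folklore] -/
theorem sum_sum_mul_sum {ι κ : Type*} [Fintype ι] [Fintype κ] (α β : ι → ℂ) (c : κ → ℂ)
    (u v : κ → ι → ℂ) :
    ∑ w : ι, ∑ w' : ι, α w * β w' * ∑ k : κ, c k * (u k w * v k w') =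
      ∑ k : κ, c k * ((∑ w : ι, α w * u k w) * ∑ w' : ι, β w' * v k w') := by
  calc ∑ w : ι, ∑ w' : ι, α w * β w' * ∑ k : κ, c k * (u k w * v k w')
      = ∑ w : ι, ∑ w' : ι, ∑ k : κ, c k * ((α w * u k w) * (β w' * v k w')) := by
        refine Finset.sum_congr rfl fun w _ => Finset.sum_congr rfl fun w' _ => ?_
        rw [Finset.mul_sum]
        exact Finset.sum_congr rfl fun k _ => by ring
    _ = ∑ w : ι, ∑ k : κ, ∑ w' : ι, c k * ((α w * u k w) * (β w' * v k w')) :=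
        Finset.sum_congr rfl fun w _ => Finset.sum_comm
    _ = ∑ k : κ, ∑ w : ι, ∑ w' : ι, c k * ((α w * u k w) * (β w' * v k w')) := Finset.sum_comm
    _ = ∑ k : κ, c k * ((∑ w : ι, α w * u k w) * ∑ w' : ι, β w' * v k w') := by
        refine Finset.sum_congr rfl fun k _ => ?_
        rw [Finset.sum_mul_sum, Finset.mul_sum]
        refine Finset.sum_congr rfl fun w _ => ?_
        rw [Finset.mul_sum]

/-- **The paired relation**: with `a = G(·,0000)`, `bb = G(·,1111)`, `φ = G(·,1000)`, `φ' = G(·,0111)` and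
the sign-twisted `ã = (-1)^{|w|} a`, `b̃ = (-1)^{|w|} bb`:
`Σ_q ⟨ã, c_q φ⟩ ⟨b̃, c_q φ'⟩ + Σ_k θ_k ⟨a, G(·,fA k)⟩ ⟨bb, G(·,fB k)⟩ = 0`. [folklore] -/
theorem corner_pairing {b : ℕ} {G : QReg (b + 4) → ℂ}
    (hG : (∀ u v : QReg (b + 4), ∑ p : Fin (b + 4) × Bool, (majorana (b + 4) p.1 p.2 *ᵥ G) u * (majorana (b + 4) p.1 p.2 *ᵥ G) v = 0)) :
    (∑ q : Fin b × Bool, (star (fun w => bsign w * cond4 G s0000 w) ⬝ᵥ (majorana b q.1 q.2 *ᵥ cond4 G s1000)) *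
        (star (fun w => bsign w * cond4 G s1111 w) ⬝ᵥ (majorana b q.1 q.2 *ᵥ cond4 G s0111))) +
      ∑ k : Fin 4, theta k * ((star (cond4 G s0000) ⬝ᵥ cond4 G (fA k)) * (star (cond4 G s1111) ⬝ᵥ cond4 G (fB k))) = 0 := by
  set α : QReg b → ℂ := fun w => star (bsign w * cond4 G s0000 w) with hα
  set β : QReg b → ℂ := fun w => star (bsign w * cond4 G s1111 w) with hβ
  have hrel := corner_relation hG
  -- multiply the relation at (w, w') by α w * β w' and sum
  have hzero : ∑ w : QReg b, ∑ w' : QReg b, α w * β w' *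
      ((∑ q : Fin b × Bool, (majorana b q.1 q.2 *ᵥ cond4 G s1000) w * (majorana b q.1 q.2 *ᵥ cond4 G s0111) w') +
        bsign w * bsign w' * ∑ k : Fin 4, theta k * (cond4 G (fA k) w * cond4 G (fB k) w')) = 0 :=
    Finset.sum_eq_zero fun w _ => Finset.sum_eq_zero fun w' _ => by rw [hrel w w', mul_zero]
  -- expand
  have hsplit : ∀ w w' : QReg b, α w * β w' *
      ((∑ q : Fin b × Bool, (majorana b q.1 q.2 *ᵥ cond4 G s1000) w * (majorana b q.1 q.2 *ᵥ cond4 G s0111) w') +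
        bsign w * bsign w' * ∑ k : Fin 4, theta k * (cond4 G (fA k) w * cond4 G (fB k) w')) =
      α w * β w' * (∑ q : Fin b × Bool, (1 : ℂ) * ((majorana b q.1 q.2 *ᵥ cond4 G s1000) w *
        (majorana b q.1 q.2 *ᵥ cond4 G s0111) w')) +
      (α w * bsign w) * (β w' * bsign w') * ∑ k : Fin 4, theta k * (cond4 G (fA k) w * cond4 G (fB k) w') := by
    intro w w'
    simp only [one_mul]
    ring
  simp_rw [hsplit] at hzero
  rw [Finset.sum_congr rfl fun w _ => Finset.sum_add_distrib, Finset.sum_add_distrib,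
    sum_sum_mul_sum, sum_sum_mul_sum] at hzero
  -- identify the two pieces
  have hαs : ∀ w, α w * bsign w = star (cond4 G s0000 w) := by
    intro w
    rw [hα]
    simp only [star_mul', star_bsign]
    rw [mul_comm (bsign w) _, mul_assoc, bsign_sq, mul_one]
  have hβs : ∀ w, β w * bsign w = star (cond4 G s1111 w) := by
    intro w
    rw [hβ]
    simp only [star_mul', star_bsign]
    rw [mul_comm (bsign w) _, mul_assoc, bsign_sq, mul_one]
  simp only [one_mul, hαs, hβs] at hzero
  convert hzero using 2
  · refine Finset.sum_congr rfl fun q _ => ?_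
    rfl
  · refine Finset.sum_congr rfl fun k _ => ?_
    rfl

/-- `|⟨a, c⟩| ≤ ‖a‖ ‖c‖` with square roots of `normSq`. [folklore] -/
theorem norm_star_dotProduct_le_sqrt {n : ℕ} (a c : QReg n → ℂ) :
    ‖star a ⬝ᵥ c‖ ≤ Real.sqrt (normSq a) * Real.sqrt (normSq c) := by
  rw [← Real.sqrt_mul (normSq_nonneg' a), ← Real.sqrt_sq (norm_nonneg (star a ⬝ᵥ c))]
  exact Real.sqrt_le_sqrt (norm_star_dotProduct_sq_le a c)

/-- AM–GM for square roots: `√(x y) ≤ (x + y)/2`. [folklore] -/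
theorem sqrt_mul_le_half {x y : ℝ} (hx : 0 ≤ x) (hy : 0 ≤ y) : Real.sqrt (x * y) ≤ (x + y) / 2 := by
  rw [show (x + y) / 2 = Real.sqrt (((x + y) / 2) ^ 2) by rw [Real.sqrt_sq (by positivity)]]
  exact Real.sqrt_le_sqrt (by nlinarith [sq_nonneg (x - y)])

/-- The ten last-block strings used are distinct: their conditional masses add up to at most `‖G‖²`.
[folklore] -/
theorem ten_le_normSq {b : ℕ} (G : QReg (b + 4) → ℂ) :
    normSq (cond4 G s0000) + normSq (cond4 G s1111) +
      ((normSq (cond4 G (fA 1)) + normSq (cond4 G (fB 1))) + (normSq (cond4 G (fA 2)) + normSq (cond4 G (fB 2))) +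
        (normSq (cond4 G (fA 3)) + normSq (cond4 G (fB 3)))) +
      (normSq (cond4 G s1000) + normSq (cond4 G s0111)) ≤ normSq G := by
  classical
  rw [normSq_eq_sum_cond4]
  set N : QReg 4 → ℝ := fun x => normSq (cond4 G x) with hN
  have hN0 : ∀ x, 0 ≤ N x := fun x => normSq_nonneg' _
  have key : ∑ x ∈ ({s0000, s1111, fA 1, fB 1, fA 2, fB 2, fA 3, fB 3, s1000, s0111} : Finset (QReg 4)), N x =
      N s0000 + N s1111 + ((N (fA 1) + N (fB 1)) + (N (fA 2) + N (fB 2)) + (N (fA 3) + N (fB 3))) +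
        (N s1000 + N s0111) := by
    rw [Finset.sum_insert (by decide), Finset.sum_insert (by decide), Finset.sum_insert (by decide),
      Finset.sum_insert (by decide), Finset.sum_insert (by decide), Finset.sum_insert (by decide),
      Finset.sum_insert (by decide), Finset.sum_insert (by decide), Finset.sum_insert (by decide),
      Finset.sum_singleton]
    ring
  calc N s0000 + N s1111 + ((N (fA 1) + N (fB 1)) + (N (fA 2) + N (fB 2)) + (N (fA 3) + N (fB 3))) +
        (N s1000 + N s0111)
      = ∑ x ∈ ({s0000, s1111, fA 1, fB 1, fA 2, fB 2, fA 3, fB 3, s1000, s0111} : Finset (QReg 4)), N x :=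
        key.symm
    _ ≤ ∑ x, N x := Finset.sum_le_univ_sum_of_nonneg hN0

/-- **THE CORNER LEMMA.** For every vector `G` on `b + 4` wires satisfying the quadratic relations (in
particular every Gaussian state), the conditional vectors at the two corners `0000`, `1111` of the last
block satisfy `‖G(·,0000)‖ + ‖G(·,1111)‖ ≤ ‖G‖`. (At `b = 0` this is `|g₀| + |g₁₅| ≤ ‖g‖`, Cudby–Strelchuk
Lemma 1.) [folklore] -/
theorem corner_lemma {b : ℕ} {G : QReg (b + 4) → ℂ}
    (hG : (∀ u v : QReg (b + 4), ∑ p : Fin (b + 4) × Bool, (majorana (b + 4) p.1 p.2 *ᵥ G) u * (majorana (b + 4) p.1 p.2 *ᵥ G) v = 0)) :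
    Real.sqrt (normSq (cond4 G s0000)) + Real.sqrt (normSq (cond4 G s1111)) ≤ Real.sqrt (normSq G) := by
  -- abbreviations
  set a := cond4 G s0000 with ha
  set bb := cond4 G s1111 with hbb
  set Na := normSq a with hNa
  set Nb := normSq bb with hNb
  have hNa0 : 0 ≤ Na := normSq_nonneg' _
  have hNb0 : 0 ≤ Nb := normSq_nonneg' _
  have hten := ten_le_normSq G
  -- the paired relation, with the k = 0 term isolated
  have hpair := corner_pairing hG
  rw [Fin.sum_univ_four, theta_zero] at hpair
  have h0 : (star (cond4 G s0000) ⬝ᵥ cond4 G (fA 0)) * (star (cond4 G s1111) ⬝ᵥ cond4 G (fB 0)) =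
      ((Na * Nb : ℝ) : ℂ) := by
    show (star a ⬝ᵥ a) * (star bb ⬝ᵥ bb) = _
    rw [star_dotProduct_self_eq_normSq, star_dotProduct_self_eq_normSq]
    push_cast
    ring
  rw [h0] at hpair
  -- complex quantities
  set Bt := ∑ q : Fin b × Bool, (star (fun w => bsign w * cond4 G s0000 w) ⬝ᵥ (majorana b q.1 q.2 *ᵥ cond4 G s1000)) *
    (star (fun w => bsign w * cond4 G s1111 w) ⬝ᵥ (majorana b q.1 q.2 *ᵥ cond4 G s0111)) with hBt
  set A : Fin 4 → ℂ := fun k => star (cond4 G s0000) ⬝ᵥ cond4 G (fA k) with hA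
  set B : Fin 4 → ℂ := fun k => star (cond4 G s1111) ⬝ᵥ cond4 G (fB k) with hB
  have hiso : (((2 : ℝ) * (Na * Nb) : ℝ) : ℂ) = -(Bt + theta 1 * (A 1 * B 1) + theta 2 * (A 2 * B 2) +
      theta 3 * (A 3 * B 3)) := by
    push_cast at hpair ⊢
    linear_combination hpair
  -- norm bounds
  set Sφ := Real.sqrt (normSq (cond4 G s1000)) * Real.sqrt (normSq (cond4 G s0111)) with hSφ
  set P := Real.sqrt Na * Real.sqrt Nb with hP
  have hP0 : 0 ≤ P := by positivity
  have hSφ0 : 0 ≤ Sφ := by positivity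
  have hBt : ‖Bt‖ ≤ 2 * P * Sφ := by
    have h := majorana_bilinear_bound (fun w => bsign w * cond4 G s0000 w) (fun w => bsign w * cond4 G s1111 w)
      (cond4 G s1000) (cond4 G s0111)
    rw [normSq_bsign_mul, normSq_bsign_mul] at h
    have h' : ‖Bt‖ ^ 2 ≤ (2 * P * Sφ) ^ 2 := by
      have e : (2 * P * Sφ) ^ 2 = 4 * normSq (cond4 G s0000) * normSq (cond4 G s1111) *
          normSq (cond4 G s1000) * normSq (cond4 G s0111) := by
        rw [hP, hSφ, hNa, hNb, ha, hbb, mul_pow, mul_pow, mul_pow, mul_pow,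
          Real.sq_sqrt (normSq_nonneg' _), Real.sq_sqrt (normSq_nonneg' _),
          Real.sq_sqrt (normSq_nonneg' _), Real.sq_sqrt (normSq_nonneg' _)]
        ring
      rw [e]
      exact h
    calc ‖Bt‖ = Real.sqrt (‖Bt‖ ^ 2) := (Real.sqrt_sq (norm_nonneg _)).symm
      _ ≤ Real.sqrt ((2 * P * Sφ) ^ 2) := Real.sqrt_le_sqrt h'
      _ = 2 * P * Sφ := Real.sqrt_sq (by positivity)
  have hAk : ∀ k, ‖A k‖ ≤ Real.sqrt Na * Real.sqrt (normSq (cond4 G (fA k))) := fun k =>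
    norm_star_dotProduct_le_sqrt _ _
  have hBk : ∀ k, ‖B k‖ ≤ Real.sqrt Nb * Real.sqrt (normSq (cond4 G (fB k))) := fun k =>
    norm_star_dotProduct_le_sqrt _ _
  have hABk : ∀ k, ‖theta k * (A k * B k)‖ ≤
      2 * P * (Real.sqrt (normSq (cond4 G (fA k))) * Real.sqrt (normSq (cond4 G (fB k)))) := by
    intro k
    rw [norm_mul, norm_mul]
    have h1 := norm_theta_le k
    have h2 := hAk k
    have h3 := hBk k
    have h4 : ‖A k‖ * ‖B k‖ ≤ (Real.sqrt Na * Real.sqrt (normSq (cond4 G (fA k)))) *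
        (Real.sqrt Nb * Real.sqrt (normSq (cond4 G (fB k)))) :=
      mul_le_mul h2 h3 (norm_nonneg _) (by positivity)
    calc ‖theta k‖ * (‖A k‖ * ‖B k‖)
        ≤ 2 * ((Real.sqrt Na * Real.sqrt (normSq (cond4 G (fA k)))) *
          (Real.sqrt Nb * Real.sqrt (normSq (cond4 G (fB k))))) :=
          mul_le_mul h1 h4 (by positivity) (by norm_num)
      _ = 2 * P * (Real.sqrt (normSq (cond4 G (fA k))) * Real.sqrt (normSq (cond4 G (fB k)))) := by
          rw [hP]; ring
  -- the main inequality `2 Na Nb ≤ 2 P Q`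
  set Q := Sφ + (Real.sqrt (normSq (cond4 G (fA 1))) * Real.sqrt (normSq (cond4 G (fB 1))) +
    Real.sqrt (normSq (cond4 G (fA 2))) * Real.sqrt (normSq (cond4 G (fB 2))) +
    Real.sqrt (normSq (cond4 G (fA 3))) * Real.sqrt (normSq (cond4 G (fB 3)))) with hQ
  have hmain : 2 * (Na * Nb) ≤ 2 * P * Q := by
    have hn : 2 * (Na * Nb) = ‖(((2 : ℝ) * (Na * Nb) : ℝ) : ℂ)‖ := by
      rw [Complex.norm_real, Real.norm_eq_abs, abs_of_nonneg (by positivity)]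
    rw [hn, hiso, norm_neg]
    calc ‖Bt + theta 1 * (A 1 * B 1) + theta 2 * (A 2 * B 2) + theta 3 * (A 3 * B 3)‖
        ≤ ‖Bt‖ + ‖theta 1 * (A 1 * B 1)‖ + ‖theta 2 * (A 2 * B 2)‖ + ‖theta 3 * (A 3 * B 3)‖ := by
          refine (norm_add_le _ _).trans ?_
          refine add_le_add ((norm_add_le _ _).trans (add_le_add (norm_add_le _ _) le_rfl)) le_rfl
      _ ≤ 2 * P * Sφ + 2 * P * (Real.sqrt (normSq (cond4 G (fA 1))) * Real.sqrt (normSq (cond4 G (fB 1)))) +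
          2 * P * (Real.sqrt (normSq (cond4 G (fA 2))) * Real.sqrt (normSq (cond4 G (fB 2)))) +
          2 * P * (Real.sqrt (normSq (cond4 G (fA 3))) * Real.sqrt (normSq (cond4 G (fB 3)))) :=
          add_le_add (add_le_add (add_le_add hBt (hABk 1)) (hABk 2)) (hABk 3)
      _ = 2 * P * Q := by rw [hQ]; ring
  -- `Q ≤ (‖G‖² − Na − Nb)/2`
  have hQle : Q ≤ (normSq G - Na - Nb) / 2 := by
    have e1 : Sφ ≤ (normSq (cond4 G s1000) + normSq (cond4 G s0111)) / 2 := by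
      rw [hSφ, ← Real.sqrt_mul (normSq_nonneg' _)]
      exact sqrt_mul_le_half (normSq_nonneg' _) (normSq_nonneg' _)
    have e2 : ∀ k, Real.sqrt (normSq (cond4 G (fA k))) * Real.sqrt (normSq (cond4 G (fB k))) ≤
        (normSq (cond4 G (fA k)) + normSq (cond4 G (fB k))) / 2 := by
      intro k
      rw [← Real.sqrt_mul (normSq_nonneg' _)]
      exact sqrt_mul_le_half (normSq_nonneg' _) (normSq_nonneg' _)
    have := e2 1; have := e2 2; have := e2 3
    rw [hQ]
    rw [← ha, ← hbb, ← hNa, ← hNb] at hten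
    linarith
  -- hence `P ≤ (‖G‖² − Na − Nb)/2`
  have hPsq : P * P = Na * Nb := by
    rw [hP]
    calc Real.sqrt Na * Real.sqrt Nb * (Real.sqrt Na * Real.sqrt Nb)
        = (Real.sqrt Na * Real.sqrt Na) * (Real.sqrt Nb * Real.sqrt Nb) := by ring
      _ = Na * Nb := by rw [Real.mul_self_sqrt hNa0, Real.mul_self_sqrt hNb0]
  have hR0 : 0 ≤ (normSq G - Na - Nb) / 2 := by
    have : 0 ≤ Q := by rw [hQ]; positivity
    linarith
  have hPle : P ≤ (normSq G - Na - Nb) / 2 := by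
    by_cases hPz : P = 0
    · rw [hPz]; exact hR0
    · have hPpos : 0 < P := lt_of_le_of_ne hP0 (Ne.symm hPz)
      have : P ≤ Q := by nlinarith
      exact this.trans hQle
  -- conclude
  have hsq : (Real.sqrt Na + Real.sqrt Nb) ^ 2 ≤ normSq G := by
    calc (Real.sqrt Na + Real.sqrt Nb) ^ 2 = Na + Nb + 2 * P := by
          rw [hP, add_sq, Real.sq_sqrt hNa0, Real.sq_sqrt hNb0]; ring
      _ ≤ normSq G := by linarith
  calc Real.sqrt Na + Real.sqrt Nb = Real.sqrt ((Real.sqrt Na + Real.sqrt Nb) ^ 2) :=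
        (Real.sqrt_sq (by positivity)).symm
    _ ≤ Real.sqrt (normSq G) := Real.sqrt_le_sqrt hsq

end Summit.QuantumAdvantage.QuantumAdvantage.Theorems.GaussRankPolyImpliesPPoly.Negative
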